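import Summits.Ventures.LatticeQCDFlow.Scaling.IdealStarPooledCollector

/-!
HONEST FRAMING: exact (Metropolis-corrected) sampling algorithms for lattice gauge theory; figures
of merit are autocorrelation/cost numbers at stated couplings and volumes; no continuum-physics
claim.

# IdealStarKLogKLawFree — THE TWO-SIDED `K·log K` LAW OF THE IDEALISED HOT-ONLY STAR FOR EVERY CONTENT LAW: AT UNIFORM LISTING (`m = cK`), `K ≥ 2`, `0 < t < 1`, EXACT HOT SAMPLER,
# ANY POSITIVE `ν` ON ANY `S` WITH `|S| ≥ 2`: `(K/t − 1)·log(K/max{64, 8√(2(K+1))}) ≤ t_mix(1/4) ≤ ⌈(2cK/(t(1−t)c))·log(4(K+1)/t)⌉` (lean-2 GEN-45, ours)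

Venture-side (OURS).  Cell `lqcd-flow` (pub-lqcd), unit `pub-lqcd-lean-2-g45`, 2026-08-31.  Chapter AE, file 8 — the assembly of file 7 (the law-free `½·log K` floor) with chapter L file 15's
ceiling.  `Scaling/IdealStarKLogKLaw` (GEN-27) had the two-sided law `(K/(t(1−t)) − 1)·log(K/32) ≤ t_mix(1/4) ≤ ⌈((K+t)/(t(1−t)))·log(…)⌉` for `K ≥ 8` on a configuration space with
`|S| ≥ 20(K+1)` (a start rare for `ν`); here the logarithm on the floor side is obtained for EVERY positive content law on every `S` with at least two points — from the
configuration with every level at a content of mass `≤ ½` — at the price of the factor `½` inside it (`log(K/√K)`) and the unit `K/t` in place of `K/(t(1−t))`.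

* `exists_content_le_half` (`|S| ≥ 2`, `Σν = 1` ⇒ some `ν(u) ≤ ½`), **`idealStar_KlogK_lawFree`** (the conjunction for a given `u` with `ν(u) ≤ ½`),
  **`idealStar_KlogK_lawFree_of_card`** (the conjunction for every positive unit-mass `ν` once `|S| ≥ 2`).

Reading (no numerics implied): `log(K/(8√(2(K+1)))) ≥ ½·log(K/130)` for `K ≥ 1`, so for `K ≥ 2¹⁴` the floor is at least `(K/(4t))·log K`, against the ceiling's `(2K/(t(1−t)))·log(4(K+1)/t)`:
the idealised star's mixing time is of order `K·log K` in `K` at every fixed swap fraction, whatever the content law — the coupon-collector logarithm is paid even with two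
contents, where no start is rare.  NOT CLAIMED: the unit `1/(1−t)` on the floor side for general `ν` (GEN-27's unit-survival floor keeps its `|S| ≥ 20(K+1)`); constants.
Literature grade (cell rule): OWN assembly; nothing cited as a fact; no new bib keys.
-/

noncomputable section

open Finset Function
open Literature.Probability.MarkovChains

namespace Summit.Ventures.LatticeQCDFlow.Scaling

section KLogKLawFree
variable {S : Type*} [Fintype S] [DecidableEq S] {K m : ℕ} (κ : Fin m → Fin K) {ν : S → ℝ} {M : Fin (K + 1) → S → S → ℝ} {t : ℝ}

omit κ [DecidableEq S] in
/-- On a space with at least two points every probability vector has a point of mass `≤ ½`. [ours] -/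
theorem exists_content_le_half (hS : 2 ≤ Fintype.card S) (hν0 : ∀ v, 0 ≤ ν v) (hν1 : ∑ v, ν v = 1) : ∃ u, ν u ≤ 1 / 2 := by
  classical
  by_contra h
  push Not at h
  obtain ⟨a, b, hab⟩ := Fintype.exists_pair_of_one_lt_card (α := S) (by omega)
  have h2 : ν a + ν b ≤ ∑ v, ν v := by
    rw [← Finset.sum_pair hab]
    exact Finset.sum_le_sum_of_subset_of_nonneg (subset_univ _) fun v _ _ => hν0 v
  linarith [h a, h b]

/-- **THE TWO-SIDED LAW FOR A GIVEN CONTENT `u` WITH `ν(u) ≤ ½`:** at uniform listing (`c ≥ 1` entries per cold level, `m = cK`), `K ≥ 2`, `0 < t < 1`, exact hot sampler,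
`ν`-reversible cold kernels: **`(K/t − 1)·log(K/max{64, 8√(2(K+1))}) ≤ t_mix(1/4) ≤ ⌈(2m/(t(1−t)c))·log((K+1)/(t/4))⌉`**. [ours] -/
theorem idealStar_KlogK_lawFree (hm : 1 ≤ m) (ht0 : 0 < t) (ht1 : t < 1) (hK : 2 ≤ K) (hν : ∀ v, 0 < ν v) (hν1 : ∑ v, ν v = 1)
    (hM : ∀ k, IsRowStochastic (M k)) (hMrev : ∀ k, DetailedBalance ν (M k)) (hM0 : ∀ u v, M 0 u v = ν v)
    {c : ℕ} (hc1 : 1 ≤ c) (hunif : ∀ i : Fin K, (univ.filter fun r : Fin m => κ r = i).card = c) (hmc : m = c * K)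
    (u : S) (hu : ν u ≤ 1 / 2) :
    ((K : ℝ) / t - 1) * Real.log ((K : ℝ) / max 64 (8 * Real.sqrt (2 * ((K : ℝ) + 1))))
        ≤ (mixingTime (fun y z : Fin (K + 1) → S => t * ptGraphSwap (fun _ : Fin (K + 1) => ν)
            (fun r : Fin m => (((0 : Fin (K + 1)), (κ r).succ) : Fin (K + 1) × Fin (K + 1))) (fun _ => Equiv.refl S) y z
            + (1 - t) * prodKernel (fun k : Fin (K + 1) => if k = 0 then (1 : ℝ) else 0) M y z)
          (tensorFun (fun _ : Fin (K + 1) => ν)) (1 / 4) : ℝ) ∧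
      mixingTime (fun y z : Fin (K + 1) → S => t * ptGraphSwap (fun _ : Fin (K + 1) => ν)
            (fun r : Fin m => (((0 : Fin (K + 1)), (κ r).succ) : Fin (K + 1) × Fin (K + 1))) (fun _ => Equiv.refl S) y z
            + (1 - t) * prodKernel (fun k : Fin (K + 1) => if k = 0 then (1 : ℝ) else 0) M y z)
          (tensorFun (fun _ : Fin (K + 1) => ν)) (1 / 4)
        ≤ ⌈2 * (m : ℝ) / (t * (1 - t) * c) * Real.log (((K : ℝ) + 1) / (t * (1 / 4)))⌉₊ := by
  have hc : ∀ p : Fin K, c ≤ (univ.filter (fun r : Fin m => κ r = p)).card := fun p => (hunif p).ge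
  have hcm : c ≤ m := by rw [hmc]; exact Nat.le_mul_of_pos_right c (by omega)
  exact ⟨idealStar_mixingTime_ge_lawFree κ hm ht0 ht1 hK hν hν1 hM hMrev hM0 hc1 hunif hmc u hu,
    idealStar_mixingTime_le κ hm ht0 ht1 hν hν1 hM hM0 hc1 hc hcm (by norm_num)⟩

/-- **THE TWO-SIDED `K·log K` LAW OF THE IDEALISED STAR FOR EVERY CONTENT LAW:** `|S| ≥ 2`, any positive unit-mass `ν`, uniform listing, `K ≥ 2`, `0 < t < 1`: there is a content `u`
(any `u` with `ν(u) ≤ ½`) such that from `y_u ≡ u` the chain is not mixed before `(K/t − 1)·log(K/max{64, 8√(2(K+1))})` steps, while from every start it is `¼`-mixed after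
`⌈(2m/(t(1−t)c))·log(4(K+1)/t)⌉`. [ours] -/
theorem idealStar_KlogK_lawFree_of_card (hS : 2 ≤ Fintype.card S) (hm : 1 ≤ m) (ht0 : 0 < t) (ht1 : t < 1) (hK : 2 ≤ K) (hν : ∀ v, 0 < ν v)
    (hν1 : ∑ v, ν v = 1) (hM : ∀ k, IsRowStochastic (M k)) (hMrev : ∀ k, DetailedBalance ν (M k)) (hM0 : ∀ u v, M 0 u v = ν v)
    {c : ℕ} (hc1 : 1 ≤ c) (hunif : ∀ i : Fin K, (univ.filter fun r : Fin m => κ r = i).card = c) (hmc : m = c * K) :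
    ((K : ℝ) / t - 1) * Real.log ((K : ℝ) / max 64 (8 * Real.sqrt (2 * ((K : ℝ) + 1))))
        ≤ (mixingTime (fun y z : Fin (K + 1) → S => t * ptGraphSwap (fun _ : Fin (K + 1) => ν)
            (fun r : Fin m => (((0 : Fin (K + 1)), (κ r).succ) : Fin (K + 1) × Fin (K + 1))) (fun _ => Equiv.refl S) y z
            + (1 - t) * prodKernel (fun k : Fin (K + 1) => if k = 0 then (1 : ℝ) else 0) M y z)
          (tensorFun (fun _ : Fin (K + 1) => ν)) (1 / 4) : ℝ) ∧
      mixingTime (fun y z : Fin (K + 1) → S => t * ptGraphSwap (fun _ : Fin (K + 1) => ν)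
            (fun r : Fin m => (((0 : Fin (K + 1)), (κ r).succ) : Fin (K + 1) × Fin (K + 1))) (fun _ => Equiv.refl S) y z
            + (1 - t) * prodKernel (fun k : Fin (K + 1) => if k = 0 then (1 : ℝ) else 0) M y z)
          (tensorFun (fun _ : Fin (K + 1) => ν)) (1 / 4)
        ≤ ⌈2 * (m : ℝ) / (t * (1 - t) * c) * Real.log (((K : ℝ) + 1) / (t * (1 / 4)))⌉₊ := by
  obtain ⟨u, hu⟩ := exists_content_le_half hS (fun v => (hν v).le) hν1
  exact idealStar_KlogK_lawFree κ hm ht0 ht1 hK hν hν1 hM hMrev hM0 hc1 hunif hmc u hu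

end KLogKLawFree

end Summit.Ventures.LatticeQCDFlow.Scaling

end
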